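import Mathlib
import Literature.MathematicalPhysics.QuantumManyBody.BoseGasFreeDirichletBEC
import Summits.AtomisticToContinuum.BoseEinsteinCondensation.Theorems.BECCellInformationTwoScaleReductionLSIBox

/-!
# Route `BECCellInformation` — support item `TwoScaleReduction` (stmt-AtomisticToContinuum-13443):
# the exact KL chain rule over the cell tiling, at a fixed bath configuration

Helper file (`--supports stmt-AtomisticToContinuum-13443`). For a `C¹` one-body function
`f : ℝ³ → ℂ` that is pointwise equal to its modulus (`f ≥ 0`, as for the slices
`x ↦ Ψ(x, Y)` of a non-negative trial state) and vanishes off the open box `Λ_L`, write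
`φ = |f|²`, `m = ∫ φ`, tile `[0, L)³` by the `M³` half-open cubes `Q_q` of side `s = L/M` used by
the route (`{y | ∀ j, y j ∈ [q_j s, (q_j + 1) s)}` — these are the `subCell s q` of
`BoseGasFreeDirichletBEC`, `routeCell_eq_subCell`), and `A_q = ∫_{Q_q} φ`. Then
(`fibre_two_scale`)

  `∫_{Λ_L} (m/L³) klFun(L³ φ / m) ≤ Σ_q (m/M³) klFun(M³ A_q / m) + 3 m + s² ∫ |∇f|²`

in `[0, ∞]`: the left side is `m · KL(p ‖ u_Λ)` (`p = φ/m`), the first term on the right is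
`m · KL(Q ‖ ū)` for the cell law `Q(q) = A_q / m` (both junk-free through Mathlib's
`InformationTheory.klFun`), the EXACT chain rule
`KL(p ‖ u_Λ) = KL(Q ‖ ū) + Σ_q Q(q) KL(p_q ‖ u_q)` [Cover–Thomas, Thm. 2.5.3] is summed over the
tiling (`integral_eq_sum_subCell`), and the within-cell entropies are paid by the defective cube
log-Sobolev inequality `lsi_cell` of `…LSIBox.lean` (`A_q KL(p_q ‖ u_q) ≤ 3 A_q + s² ∫_{Q_q} |∇|f||²`)
with `|∇|f|| ≤ |∇f|` (`ofReal_sum_sq_fderiv_norm_le`, `gradSqC`).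
-/

noncomputable section

namespace Summit.AtomisticToContinuum.BoseEinsteinCondensation.Theorems

open MeasureTheory Set
open scoped ENNReal NNReal Topology

namespace TwoScaleReduction

open Literature.MathematicalPhysics.QuantumManyBody.BoseGas InformationTheory

/-! ### The cells of the route are the `subCell`s of the tree -/

/-- The route's half-open cell `{y | ∀ j, y j ∈ [q_j s, (q_j + 1) s)}` is `subCell s q`.
[folklore] -/
theorem routeCell_eq_subCell {M : ℕ} (s : ℝ) (q : Fin 3 → Fin M) :
    {y : Space | ∀ j, y j ∈ Ico (((q j : ℕ) : ℝ) * s) ((((q j : ℕ) : ℝ) + 1) * s)} = subCell s q := by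
  ext y
  rw [mem_subCell]
  simp only [Set.mem_setOf_eq, Set.mem_Ico]
  refine forall_congr' fun j => ?_
  rw [show (((q j : ℕ) : ℝ) + 1) * s = s * ((q j : ℕ) : ℝ) + s by ring, mul_comm _ s]

/-- The same cell written with upper end `q_j s + s`. [folklore] -/
theorem IcoCell_eq_subCell {M : ℕ} (s : ℝ) (q : Fin 3 → Fin M) :
    {y : Space | ∀ j, y j ∈ Ico (((q j : ℕ) : ℝ) * s) (((q j : ℕ) : ℝ) * s + s)} = subCell s q := by
  rw [← routeCell_eq_subCell s q]
  ext y
  simp only [Set.mem_setOf_eq, add_mul, one_mul]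

/-- The sub-cells are pairwise disjoint. [folklore] -/
theorem pairwise_disjoint_subCell {M : ℕ} {s : ℝ} (hs : 0 < s) :
    Pairwise (Function.onFun Disjoint fun q : Fin 3 → Fin M => subCell s q) := fun _ _ hne =>
  Set.disjoint_left.2 fun _ hx hx' => not_mem_subCell_of_ne hs hne hx hx'

/-- The sub-cells cover the big cell `[0, Ms)³`. [folklore] -/
theorem iUnion_subCell {M : ℕ} {s : ℝ} (hs : 0 < s) :
    (⋃ q : Fin 3 → Fin M, subCell s q) = cell (M * s) := by
  ext x
  simp only [Set.mem_iUnion]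
  exact ⟨fun ⟨q, hq⟩ => subCell_subset_cell hs q hq, fun hx => exists_mem_subCell hs hx⟩

/-- **Tiling**: a function vanishing off the open box `Λ_L`, `L = Ms`, integrates to the sum of
its integrals over the `M³` half-open sub-cells. [folklore] -/
theorem integral_eq_sum_subCell {M : ℕ} {s L : ℝ} (hs : 0 < s) (hMs : (M : ℝ) * s = L)
    {F : Space → ℝ} (hF0 : ∀ x, x ∉ box L → F x = 0) (hFi : Integrable F) :
    ∫ x, F x = ∑ q : Fin 3 → Fin M, ∫ x in subCell s q, F x := by
  have hsub : box L ⊆ cell (M * s) := fun x hx k => by rw [hMs]; exact Ioo_subset_Ico_self (hx k)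
  rw [← integral_iUnion_fintype (fun q => measurableSet_subCell s q) (pairwise_disjoint_subCell hs)
    (fun q => hFi.integrableOn), iUnion_subCell hs]
  exact (setIntegral_eq_integral_of_forall_compl_eq_zero fun x hx => hF0 x fun h => hx (hsub h)).symm

/-- `φ log(c φ)`-type integrands are continuous. [folklore] -/
theorem continuous_mul_log_mul_div {X : Type*} [TopologicalSpace X] {φ : X → ℝ}
    (hφ : Continuous φ) (a b : ℝ) : Continuous fun x => φ x * Real.log (a * φ x / b) := by
  have e : (fun x => φ x * Real.log (a * φ x / b)) = fun x => φ x * Real.log (a / b * φ x) := by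
    funext x; rw [mul_div_right_comm]
  rw [e]
  by_cases hc : a / b = 0
  · simp only [hc, zero_mul, Real.log_zero, mul_zero]; exact continuous_const
  · have e2 : (fun x => φ x * Real.log (a / b * φ x)) =
        fun x => (a / b)⁻¹ * ((a / b * φ x) * Real.log (a / b * φ x)) := by
      funext x
      calc φ x * Real.log (a / b * φ x)
          = ((a / b)⁻¹ * (a / b)) * φ x * Real.log (a / b * φ x) := by
            rw [inv_mul_cancel₀ hc, one_mul]
        _ = (a / b)⁻¹ * ((a / b * φ x) * Real.log (a / b * φ x)) := by ring
    rw [e2]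
    exact continuous_const.mul (Real.continuous_mul_log.comp (continuous_const.mul hφ))

/-- The real part of the derivative of a real-valued `C¹` map `f : ℝ³ → ℂ`: the gradient square of
`x ↦ ‖f x‖ = re f(x)` is at most `|∇f|²` (`gradSqC`). [folklore] -/
theorem ofReal_sum_sq_fderiv_norm_le {f : Space → ℂ} (hf : ContDiff ℝ 1 f)
    (hreal : ∀ x, f x = (‖f x‖ : ℂ)) (x : Space) :
    ENNReal.ofReal (∑ i, (fderiv ℝ (fun y => ‖f y‖) x (EuclideanSpace.single i 1)) ^ 2) ≤
      gradSqC f x := by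
  have hGeq : (fun y => ‖f y‖) = fun y => (f y).re := by
    funext y; rw [hreal y]; simp
  have hd : fderiv ℝ (fun y => ‖f y‖) x = Complex.reCLM.comp (fderiv ℝ f x) := by
    rw [hGeq]
    exact (Complex.reCLM.hasFDerivAt.comp x (hf.differentiable_one x).hasFDerivAt).fderiv
  rw [hd, ENNReal.ofReal_sum_of_nonneg fun i _ => sq_nonneg _]
  unfold gradSqC
  refine Finset.sum_le_sum fun i _ => ?_
  rw [ContinuousLinearMap.comp_apply, Complex.reCLM_apply]
  set w := fderiv ℝ f x (EuclideanSpace.single i 1)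
  calc ENNReal.ofReal (w.re ^ 2) ≤ ENNReal.ofReal (‖w‖ ^ 2) := by
        refine ENNReal.ofReal_le_ofReal ?_
        rw [sq, ← Complex.normSq_eq_norm_sq]; exact Complex.re_sq_le_normSq w
    _ = (‖w‖₊ : ℝ≥0∞) ^ 2 := by
        rw [ENNReal.ofReal_pow (norm_nonneg _), ofReal_norm, enorm_eq_nnnorm]

/-! ### The two-scale reduction at a fixed bath configuration -/

/-- **The two-scale reduction at fixed `Y`** (exact KL chain rule over the cell tiling plus the
defective cube LSI). Let `f : ℝ³ → ℂ` be `C¹`, pointwise equal to its modulus (`f ≥ 0`) and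
vanishing off the open box `Λ_L`; write `φ = |f|²`, `m = ∫ φ`, and tile `[0,L)³` by the `M³`
half-open cubes `Q_q` of side `s = L/M` (`M ≥ 1`), `A_q = ∫_{Q_q} φ`. Then

  `∫_{Λ_L} (m/L³) klFun(L³φ/m) ≤ Σ_q (m/M³) klFun(M³A_q/m) + 3m + s² ∫ |∇f|²`

as `[0,∞]`-valued quantities: `m · KL(p ‖ u_Λ) = m · KL(Q ‖ ū) + Σ_q A_q KL(p_q ‖ u_q)`
(chain rule, `p = φ/m`) and `A_q KL(p_q ‖ u_q) ≤ 3A_q + s² ∫_{Q_q} |∇|f||²` (`lsi_cell`),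
`|∇|f|| ≤ |∇f|`. [folklore] -/
theorem fibre_two_scale {L : ℝ} (hL : 0 < L) {M : ℕ} (hM : 1 ≤ M) {f : Space → ℂ}
    (hf : ContDiff ℝ 1 f) (hreal : ∀ x, f x = (‖f x‖ : ℂ)) (hsupp : ∀ x, x ∉ box L → f x = 0) :
    ∫⁻ x in box L, ENNReal.ofReal ((∫ z, ‖f z‖ ^ 2) / L ^ 3 *
        klFun (L ^ 3 * ‖f x‖ ^ 2 / ∫ z, ‖f z‖ ^ 2)) ≤
      ENNReal.ofReal (∑ q : Fin 3 → Fin M, (∫ z, ‖f z‖ ^ 2) / (M : ℝ) ^ 3 *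
          klFun ((M : ℝ) ^ 3 * (∫ x in {y : Space | ∀ j, y j ∈
            Ico (((q j : ℕ) : ℝ) * (L / M)) ((((q j : ℕ) : ℝ) + 1) * (L / M))}, ‖f x‖ ^ 2) /
            ∫ z, ‖f z‖ ^ 2)) +
        ENNReal.ofReal (3 * ∫ z, ‖f z‖ ^ 2) +
        ENNReal.ofReal ((L / M) ^ 2) * ∫⁻ x, gradSqC f x := by
  simp_rw [routeCell_eq_subCell]
  set s : ℝ := L / M with hs_def
  have hMpos : (0 : ℝ) < M := by exact_mod_cast hM
  have hs : 0 < s := div_pos hL hMpos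
  have hMs : (M : ℝ) * s = L := by rw [hs_def]; field_simp
  have hL3 : L ^ 3 = (M : ℝ) ^ 3 * s ^ 3 := by rw [← hMs]; ring
  set m : ℝ := ∫ z, ‖f z‖ ^ 2 with hm_def
  set A : (Fin 3 → Fin M) → ℝ := fun q => ∫ x in subCell s q, ‖f x‖ ^ 2 with hA_def
  set D : Space → ℝ := fun x =>
    ∑ i, (fderiv ℝ (fun y => ‖f y‖) x (EuclideanSpace.single i 1)) ^ 2 with hD_def
  /- regularity and support -/
  have hGc : Continuous fun x => ‖f x‖ := hf.continuous.norm
  have hφc : Continuous fun x => ‖f x‖ ^ 2 := hGc.pow 2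
  have hG1 : ContDiff ℝ 1 fun x => ‖f x‖ := by
    have e : (fun x => ‖f x‖) = fun x => (f x).re := by funext x; rw [hreal x]; simp
    rw [e]; exact Complex.reCLM.contDiff.comp hf
  have hDc : Continuous D :=
    continuous_finsetSum _ fun i _ =>
      ((hG1.continuous_fderiv one_ne_zero).clm_apply continuous_const).pow 2
  have hD0 : ∀ x, 0 ≤ D x := fun x => Finset.sum_nonneg fun i _ => sq_nonneg _
  have hφ0 : ∀ x, x ∉ box L → ‖f x‖ ^ 2 = 0 := fun x hx => by simp [hsupp x hx]
  have hK : IsCompact {y : Space | ∀ j, y j ∈ Icc (0 : ℝ) L} :=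
    isCompact_IccCell (m := 3) (fun _ => 0) (fun _ => L)
  have hboxK : box L ⊆ {y : Space | ∀ j, y j ∈ Icc (0 : ℝ) L} :=
    fun y hy j => Ioo_subset_Icc_self (hy j)
  have hcellK : cell (M * s) ⊆ {y : Space | ∀ j, y j ∈ Icc (0 : ℝ) L} :=
    fun y hy j => by have h := hy j; rw [hMs] at h; exact Ico_subset_Icc_self h
  have hint : ∀ {F : Space → ℝ}, Continuous F → (∀ x, x ∉ box L → F x = 0) → Integrable F :=
    fun hF h0 => hF.integrable_of_hasCompactSupport
      (HasCompactSupport.intro hK fun x hx => h0 x fun hb => hx (hboxK hb))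
  have hm0 : 0 ≤ m := integral_nonneg fun x => sq_nonneg _
  have hA0 : ∀ q, 0 ≤ A q := fun q => integral_nonneg fun x => sq_nonneg _
  rcases hm0.eq_or_lt with hm | hm
  · -- `m = 0`: the left-hand side vanishes
    rw [← hm]
    simp
  /- the gradient term -/
  have hgrad : ENNReal.ofReal (∑ q : Fin 3 → Fin M, ∫ x in subCell s q, D x) ≤ ∫⁻ x, gradSqC f x := by
    have hDi : ∀ q : Fin 3 → Fin M, IntegrableOn D (subCell s q) := fun q =>
      (hDc.continuousOn.integrableOn_compact hK).mono_set ((subCell_subset_cell hs q).trans hcellK)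
    rw [ENNReal.ofReal_sum_of_nonneg fun q _ => setIntegral_nonneg (measurableSet_subCell s q)
      fun x _ => hD0 x]
    calc ∑ q : Fin 3 → Fin M, ENNReal.ofReal (∫ x in subCell s q, D x)
        = ∑ q : Fin 3 → Fin M, ∫⁻ x in subCell s q, ENNReal.ofReal (D x) :=
          Finset.sum_congr rfl fun q _ =>
            ofReal_integral_eq_lintegral_ofReal (hDi q) (ae_of_all _ hD0)
      _ = ∫⁻ x in cell (M * s), ENNReal.ofReal (D x) :=
          sum_setLIntegral_subCell hs (hDc.measurable.ennreal_ofReal.aemeasurable)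
      _ ≤ ∫⁻ x, ENNReal.ofReal (D x) := setLIntegral_le_lintegral _ _
      _ ≤ ∫⁻ x, gradSqC f x := lintegral_mono fun x => ofReal_sum_sq_fderiv_norm_le hf hreal x
  /- the left-hand side as a real integral -/
  have hklnn : ∀ x, 0 ≤ m / L ^ 3 * klFun (L ^ 3 * ‖f x‖ ^ 2 / m) := fun x =>
    mul_nonneg (by positivity) (klFun_nonneg (by positivity))
  have hklc : Continuous fun x => m / L ^ 3 * klFun (L ^ 3 * ‖f x‖ ^ 2 / m) :=
    continuous_const.mul (continuous_klFun.comp ((continuous_const.mul hφc).div_const _))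
  have hTint : IntegrableOn (fun x => m / L ^ 3 * klFun (L ^ 3 * ‖f x‖ ^ 2 / m)) (box L) :=
    (hklc.continuousOn.integrableOn_compact hK).mono_set hboxK
  rw [← ofReal_integral_eq_lintegral_ofReal hTint (ae_of_all _ hklnn)]
  /- Step 2: `∫_Λ (m/L³) klFun(L³φ/m) = ∫ φ log(L³φ/m)` -/
  have hvolbox : volume.real (box L) = L ^ 3 := by
    rw [measureReal_def, volume_box, ← ENNReal.ofReal_pow hL.le, ENNReal.toReal_ofReal (by positivity)]
  have hT : ∫ x in box L, m / L ^ 3 * klFun (L ^ 3 * ‖f x‖ ^ 2 / m) =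
      ∫ x, ‖f x‖ ^ 2 * Real.log (L ^ 3 * ‖f x‖ ^ 2 / m) := by
    have hpt : ∀ x, m / L ^ 3 * klFun (L ^ 3 * ‖f x‖ ^ 2 / m) =
        ‖f x‖ ^ 2 * Real.log (L ^ 3 * ‖f x‖ ^ 2 / m) + (m / L ^ 3 - ‖f x‖ ^ 2) := by
      intro x; rw [klFun_apply]; field_simp; ring
    simp_rw [hpt]
    have i1 : Integrable fun x => ‖f x‖ ^ 2 * Real.log (L ^ 3 * ‖f x‖ ^ 2 / m) :=
      hint (continuous_mul_log_mul_div hφc _ _) fun x hx => by simp [hsupp x hx]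
    have i2 : Integrable fun x => ‖f x‖ ^ 2 := hint hφc hφ0
    have hvb : volume (box L) ≠ ⊤ := by rw [volume_box]; simp
    have ic : IntegrableOn (fun _ : Space => m / L ^ 3) (box L) := integrableOn_const hvb
    have i3 : IntegrableOn (fun x => m / L ^ 3 - ‖f x‖ ^ 2) (box L) := ic.sub i2.integrableOn
    rw [integral_add i1.integrableOn i3, integral_sub ic i2.integrableOn,
      setIntegral_const, hvolbox, smul_eq_mul,
      setIntegral_eq_integral_of_forall_compl_eq_zero (s := box L) hφ0,
      setIntegral_eq_integral_of_forall_compl_eq_zero (s := box L)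
        (fun x hx => by simp [hsupp x hx]), ← hm_def]
    have hL0 : L ≠ 0 := hL.ne'
    have hz : L ^ 3 * (m / L ^ 3) = m := by field_simp
    rw [hz, sub_self, add_zero]
  rw [hT]
  /- Step 3: tiling -/
  have hTsum : ∫ x, ‖f x‖ ^ 2 * Real.log (L ^ 3 * ‖f x‖ ^ 2 / m) =
      ∑ q : Fin 3 → Fin M, ∫ x in subCell s q, ‖f x‖ ^ 2 * Real.log (L ^ 3 * ‖f x‖ ^ 2 / m) :=
    integral_eq_sum_subCell hs hMs (fun x hx => by simp [hsupp x hx])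
      (hint (continuous_mul_log_mul_div hφc _ _) fun x hx => by simp [hsupp x hx])
  have hAsum : ∑ q : Fin 3 → Fin M, A q = m :=
    (integral_eq_sum_subCell hs hMs hφ0 (hint hφc hφ0)).symm
  /- Step 4: the chain rule on each cell -/
  have hsplit : ∀ q : Fin 3 → Fin M,
      ∫ x in subCell s q, ‖f x‖ ^ 2 * Real.log (L ^ 3 * ‖f x‖ ^ 2 / m) =
        (∫ x in subCell s q, ‖f x‖ ^ 2 * Real.log (s ^ 3 * ‖f x‖ ^ 2 / A q)) +
          A q * Real.log ((M : ℝ) ^ 3 * A q / m) := by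
    intro q
    have iφ : IntegrableOn (fun x => ‖f x‖ ^ 2) (subCell s q) := (hint hφc hφ0).integrableOn
    rcases (hA0 q).eq_or_lt with hAq | hAq
    · -- empty cell: `φ = 0` a.e. on it
      have hae : (fun x => ‖f x‖ ^ 2) =ᵐ[volume.restrict (subCell s q)] 0 :=
        (integral_eq_zero_iff_of_nonneg (fun x => sq_nonneg _) iφ).1 hAq.symm
      rw [integral_eq_zero_of_ae (hae.mono fun x hx => by simp [hx]),
        integral_eq_zero_of_ae (hae.mono fun x hx => by simp [hx]), ← hAq]
      simp
    · have hpt : ∀ x, ‖f x‖ ^ 2 * Real.log (L ^ 3 * ‖f x‖ ^ 2 / m) =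
          ‖f x‖ ^ 2 * Real.log (s ^ 3 * ‖f x‖ ^ 2 / A q) +
            ‖f x‖ ^ 2 * Real.log ((M : ℝ) ^ 3 * A q / m) := by
        intro x
        rcases (sq_nonneg ‖f x‖).eq_or_lt with h0 | hpos
        · rw [← h0]; simp
        · rw [← mul_add, ← Real.log_mul (by positivity) (by positivity)]
          congr 2
          rw [hL3]; field_simp
      simp_rw [hpt]
      rw [integral_add ((hint (continuous_mul_log_mul_div hφc _ _)
          fun x hx => by simp [hsupp x hx]).integrableOn) (iφ.mul_const _), integral_mul_const]
  /- Step 5: sum over the cells: LSI on each cell, coarse entropy for the rest -/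
  have hcell : ∀ q : Fin 3 → Fin M,
      ∫ x in subCell s q, ‖f x‖ ^ 2 * Real.log (s ^ 3 * ‖f x‖ ^ 2 / A q) ≤
        3 * A q + s ^ 2 * ∫ x in subCell s q, D x := by
    intro q
    have h := lsi_cell hs (fun x => ‖f x‖) hG1 (fun j => ((q j : ℕ) : ℝ) * s)
    simp only [IcoCell_eq_subCell] at h
    exact h
  have hcoarse : ∑ q : Fin 3 → Fin M, A q * Real.log ((M : ℝ) ^ 3 * A q / m) =
      ∑ q : Fin 3 → Fin M, m / (M : ℝ) ^ 3 * klFun ((M : ℝ) ^ 3 * A q / m) := by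
    have hpt : ∀ q : Fin 3 → Fin M, m / (M : ℝ) ^ 3 * klFun ((M : ℝ) ^ 3 * A q / m) =
        A q * Real.log ((M : ℝ) ^ 3 * A q / m) + (m / (M : ℝ) ^ 3 - A q) := by
      intro q; rw [klFun_apply]; field_simp; ring
    simp_rw [hpt]
    rw [Finset.sum_add_distrib, Finset.sum_sub_distrib, hAsum, Finset.sum_const, Finset.card_univ,
      Fintype.card_fun]
    simp only [Fintype.card_fin, nsmul_eq_mul]
    have hz : ((M ^ 3 : ℕ) : ℝ) * (m / (M : ℝ) ^ 3) - m = 0 := by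
      push_cast; field_simp; ring
    rw [hz, add_zero]
  have hTle : ∫ x, ‖f x‖ ^ 2 * Real.log (L ^ 3 * ‖f x‖ ^ 2 / m) ≤
      (∑ q : Fin 3 → Fin M, m / (M : ℝ) ^ 3 * klFun ((M : ℝ) ^ 3 * A q / m)) + 3 * m +
        s ^ 2 * ∑ q : Fin 3 → Fin M, ∫ x in subCell s q, D x := by
    have h3 : 3 * m = ∑ q : Fin 3 → Fin M, 3 * A q := by rw [← Finset.mul_sum, hAsum]
    rw [hTsum, ← hcoarse, h3, Finset.mul_sum, ← Finset.sum_add_distrib, ← Finset.sum_add_distrib]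
    refine Finset.sum_le_sum fun q _ => ?_
    rw [hsplit q]
    linarith [hcell q]
  /- Step 6: back to `[0, ∞]` -/
  have hH0 : 0 ≤ ∑ q : Fin 3 → Fin M, m / (M : ℝ) ^ 3 * klFun ((M : ℝ) ^ 3 * A q / m) :=
    Finset.sum_nonneg fun q _ => mul_nonneg (by positivity) (klFun_nonneg (by
      have := hA0 q; positivity))
  have hJ0 : 0 ≤ ∑ q : Fin 3 → Fin M, ∫ x in subCell s q, D x :=
    Finset.sum_nonneg fun q _ => setIntegral_nonneg (measurableSet_subCell s q) fun x _ => hD0 x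
  calc ENNReal.ofReal (∫ x, ‖f x‖ ^ 2 * Real.log (L ^ 3 * ‖f x‖ ^ 2 / m))
      ≤ ENNReal.ofReal ((∑ q : Fin 3 → Fin M, m / (M : ℝ) ^ 3 * klFun ((M : ℝ) ^ 3 * A q / m)) +
          3 * m + s ^ 2 * ∑ q : Fin 3 → Fin M, ∫ x in subCell s q, D x) :=
        ENNReal.ofReal_le_ofReal hTle
    _ = ENNReal.ofReal (∑ q : Fin 3 → Fin M, m / (M : ℝ) ^ 3 * klFun ((M : ℝ) ^ 3 * A q / m)) +
          ENNReal.ofReal (3 * m) +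
          ENNReal.ofReal (s ^ 2) * ENNReal.ofReal (∑ q : Fin 3 → Fin M, ∫ x in subCell s q, D x) := by
        rw [ENNReal.ofReal_add (by positivity) (by positivity), ENNReal.ofReal_add hH0 (by positivity),
          ENNReal.ofReal_mul (sq_nonneg _)]
    _ ≤ _ := by gcongr

end TwoScaleReduction

end Summit.AtomisticToContinuum.BoseEinsteinCondensation.Theorems
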